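import Literature.AlgebraicGeometry.Frobenioids.ModelFrobenioidRatFunTransport
import Literature.AlgebraicGeometry.Frobenioids.ModelFrobenioidSelfEquivalenceRigidity
import Literature.AlgebraicGeometry.Frobenioids.BiratUnitsTransport
import HarnessLib

/-!
# [IUTchI] Cor 5.3 (i) / Ex 5.1 (v) engine: a self-equivalence of a MODEL Frobenioid transports the rational
# functions of ALL parallel linear pairs through ONE natural automorphism of `B` ([FrdI] Cor 4.10, Thm 5.2 (ii))

S. Mochizuki, *Inter-universal Teichmüller theory I*, kurims manuscript (May 2020), §5 Cor 5.3 (i) p. 144, proof l. 24–33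
(«category-theoreticity of the "isomorphism `𝕄^⊛(†𝒟^⊚) ⥲ †𝕄^⊛`" of Example 5.1, (v)»), Ex 5.1 (v) pp. 127–128
([IUTchI] Cor 5.3 (i) p.144) [claim: Mochizuki2012, status: disputed] (D-0012 claim key; nothing of the series is asserted;
no side taken on [IUTchIII] Cor. 3.12).  The mathematics is S. Mochizuki, *The geometry of Frobenioids I*, Kyushu J. Math.
**62** (2008): Cor 4.10 p. 90 (`Ψ` induces `Ψ^birat`), Prop 2.2 (ii) p. 45 (transport of the rational function monoid along
LINEAR arrows), Thm 5.2 (i)/(ii) pp. 100–101 (the model Frobenioid; `O^×(A^birat) ≅ B(A_D)`) [cite: MochizukiFrdI2008, Thm. 5.2 (ii) p.101].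

PROOF-ONLY (cell abc-iut, seat abc-iut-L5-t11 gen 17, row «C411-UNITS@ARITH» = BRATIO split (a), abc-iut-L5-lead RULINGS
#161 (4); 0 def / 0 instance / 0 notation / no Prop fact).  abc-iut-L1-t10's ★ `exists_comparisonData_of_equivalence`
transports `B` along an equivalence of model Frobenioids AT THE ZERO OBJECTS; the [IUTchI] Ex 5.1 (v) binder `hB` (𝔹-RATIO, ★
`Cor53iArithHratOfMonoidRigidity`) is about the units `u_f, u_g` of PARALLEL LINEAR arrows at ARBITRARY objects.  With
`T_X := ratIso_{Ψ X}⁻¹ ∘ Ψ^birat_X ∘ ratIso_X : B(X_D) ⥲ B((Ψ X)_D)` (spelled out, no definition introduced):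
§ 1 `ratTransport_pull` — naturality of `T` along EVERY LINEAR arrow (uniqueness of intertwiners, isotropic type);
§ 2 `ratTransport_divB'` — `Div_B(T_X b) = (Ψ^Φ_X)^gp(Div_B b)` at every object; § 3 **`ratTransport_ratio`** — for parallel
linear `f, g : X → Y`, `u_{Ψ g} · T_X(u_f) = u_{Ψ f} · T_X(u_g)`; § 4 the zigzag `(A, α) ⟵ (A, γ) ⟶ (A, 0)`; § 5
**`exists_unitsAut_of_selfEquivalence_over_base(Iso)`** — for `Ψ` OVER THE BASE: ONE natural automorphism `ᾱ_A` of `B(A)`,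
`Div_B`-compatible through a monoid automorphism of `Φ(A)`, with `u_{Ψ f} · η′_X^*(ᾱ(u_g)) = u_{Ψ g} · η′_X^*(ᾱ(u_f))` — the
(hratio) clause of `hB` WITH `ᾱ` INSERTED (`ᾱ = 1` IS `hB`).  Consumers: `Cor53iArithUnitsEndOfCor411` (ℱ^⊛(†𝒟^⊚), all
hypotheses discharged) and abc-iut-L5-t16's classical rigidity «BRIGID-KUMMER» (`ᾱ = 1`).  Nothing here asserts abc proved or refuted.
-/

noncomputable section

set_option backward.isDefEq.respectTransparency false

namespace Literature.AlgebraicGeometry.Frobenioids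

open CategoryTheory Opposite

universe w v u

namespace ModelFrobenioid

variable {D : Type u} [Category.{v} D] {Φ B : Dᵒᵖ ⥤ CommMonCat.{w}} {DivB : B ⟶ monoidGp Φ}
  (hBg : Objectwise (fun M _ => IsGroupLike M) B) (hΦd : Objectwise (fun M _ => IsDivisorial M) Φ)
  (hF : PreFrobenioid.IsFrobenioid (toElem Φ B DivB))
  (hiso : PreFrobenioid.IsOfIsotropicType (toElem Φ B DivB))
  (Ψ : ModelFrobenioid Φ B DivB ≌ ModelFrobenioid Φ B DivB)
  (hΨ : ∀ ⦃A A' : ModelFrobenioid Φ B DivB⦄ (f : A ⟶ A'), PreFrobenioid.IsCoAngularPreStep (toElem Φ B DivB) f →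
    PreFrobenioid.IsCoAngularPreStep (toElem Φ B DivB) (Ψ.functor.map f))
  (hb : ∀ ⦃A A' : ModelFrobenioid Φ B DivB⦄ (f g : A ⟶ A'), PreFrobenioid.BaseEquivalent (toElem Φ B DivB) f g →
    PreFrobenioid.BaseEquivalent (toElem Φ B DivB) (Ψ.functor.map f) (Ψ.functor.map g))
  (hΨ' : ∀ ⦃A A' : ModelFrobenioid Φ B DivB⦄ (f : A ⟶ A'), PreFrobenioid.IsCoAngularPreStep (toElem Φ B DivB) f →
    PreFrobenioid.IsCoAngularPreStep (toElem Φ B DivB) (Ψ.inverse.map f))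
  (hb' : ∀ ⦃A A' : ModelFrobenioid Φ B DivB⦄ (f g : A ⟶ A'), PreFrobenioid.BaseEquivalent (toElem Φ B DivB) f g →
    PreFrobenioid.BaseEquivalent (toElem Φ B DivB) (Ψ.inverse.map f) (Ψ.inverse.map g))
  (hdeg : ∀ ⦃X Y : ModelFrobenioid Φ B DivB⦄ (φ : X ⟶ Y), degFr (Ψ.functor.map φ) = degFr φ)

/-! ### § 1. Naturality of the transport along every LINEAR arrow of `C` -/

include hiso hdeg in
/-- **`T_X(Base(ψ)^* w) = Base(Ψ ψ)^* T_{X″}(w)` along every LINEAR `ψ : X → X″`** ([FrdI] Prop 2.2 (ii) for the rational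
function monoid, transported by Cor 4.10's `Ψ^birat`): `ratIso_natural` gives the intertwining squares
`ψ ∘ [Base(ψ)^* w] = [w] ∘ ψ` and `Ψψ ∘ [Base(Ψψ)^* w′] = [w′] ∘ Ψψ` in `C^birat`; `Ψ^birat` carries the first to a square
along `Ψ ψ`, and the intertwiner along the LINEAR arrow `Ψ ψ` of a Frobenioid of isotropic type is unique.
[cite: MochizukiFrdI2008, Prop. 2.2(ii) p.45] [claim: Mochizuki2012, status: disputed] -/
theorem ratTransport_pull {X X'' : ModelFrobenioid Φ B DivB} (ψ : X ⟶ X'') (hψ : degFr ψ = 1)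
    (w : B.obj (op X''.base)) :
    (ratIso hBg hΦd hF (Ψ.functor.obj X)).symm
        (PreFrobenioid.BiratUnits.equivOfEquiv Ψ hΨ hb hF hF hΨ' hb' X
          (ratIso hBg hΦd hF X (pull B (baseMap ψ) w))) =
      pull B (baseMap (Ψ.functor.map ψ))
        ((ratIso hBg hΦd hF (Ψ.functor.obj X'')).symm
          (PreFrobenioid.BiratUnits.equivOfEquiv Ψ hΨ hb hF hF hΨ' hb' X''
            (ratIso hBg hΦd hF X'' w))) := by
  have hlin₁ : PreFrobenioid.IsLinear (toElem Φ B DivB) ψ := hψ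
  have hlin₂ : PreFrobenioid.IsLinear (toElem Φ B DivB) (Ψ.functor.map ψ) := by
    change degFr (Ψ.functor.map ψ) = 1
    rw [hdeg, hψ]
  -- side 1: Prop 2.2 (ii) for `ratIso` along `ψ`, pushed through `Ψ^birat`
  have h₁ := PreFrobenioid.BiratUnits.Intertwines.map_equivalence hF hF Ψ hΨ hb
    (ratIso_natural hBg hΦd hF ψ hlin₁ w)
  -- side 2: Prop 2.2 (ii) for `ratIso` along `Ψ ψ` at the transported element
  have h₂ := ratIso_natural hBg hΦd hF (Ψ.functor.map ψ) hlin₂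
    ((ratIso hBg hΦd hF (Ψ.functor.obj X'')).symm
      (PreFrobenioid.BiratUnits.equivOfEquiv Ψ hΨ hb hF hF hΨ' hb' X'' (ratIso hBg hΦd hF X'' w)))
  rw [MulEquiv.apply_symm_apply, PreFrobenioid.BiratUnits.equivOfEquiv_apply] at h₂
  -- uniqueness of the intertwiner along the linear arrow `Ψ ψ` (isotropic type)
  have h₃ := PreFrobenioid.BiratUnits.eq_of_intertwines_of_isLinear
    (PreFrobenioid.hasBiratSquares_of_isFrobenioid hF) hiso hlin₂ h₁ h₂
  rw [MulEquiv.symm_apply_eq, PreFrobenioid.BiratUnits.equivOfEquiv_apply]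
  exact h₃

/-! ### § 2. Compatibility with `Div_B` at every object -/

section Div

variable (ΨΦ : (PreFrobenioidData.ofFunctor Φ (toElem Φ B DivB)).DivisorMonoidIsoOver
    (PreFrobenioidData.ofFunctor Φ (toElem Φ B DivB)) Ψ)
  (hdiv : ∀ ⦃A A' : ModelFrobenioid Φ B DivB⦄ (φ : A ⟶ A'),
    ΨΦ.iso A (PreFrobenioid.Div (toElem Φ B DivB) φ) = PreFrobenioid.Div (toElem Φ B DivB) (Ψ.functor.map φ))

include hdiv in
/-- **`Div_B(T_X b) = (Ψ^Φ_X)^gp(Div_B b)` at EVERY object `X`** (abc-iut-L1-t10's `ratTransport_divB`, which is stated at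
the zero objects, verbatim at an arbitrary object: Thm 5.2 (ii) "compatible with `Div_B`" on both sides and
`divHom_mapEquiv`). [cite: MochizukiFrdI2008, Thm. 5.2 (ii) p.101] [claim: Mochizuki2012, status: disputed] -/
theorem ratTransport_divB' (X : ModelFrobenioid Φ B DivB) (b : B.obj (op X.base)) :
    divB Φ B DivB (op (Ψ.functor.obj X).base)
        ((ratIso hBg hΦd hF (Ψ.functor.obj X)).symm
          (PreFrobenioid.BiratUnits.equivOfEquiv Ψ hΨ hb hF hF hΨ' hb' X (ratIso hBg hΦd hF X b))) =
      MonGp.map (ΨΦ.iso X).toMonoidHom (divB Φ B DivB (op X.base) b) := by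
  rw [← divHom_ratIso hBg hΦd hF, MulEquiv.apply_symm_apply, PreFrobenioid.BiratUnits.equivOfEquiv_apply,
    PreFrobenioid.BiratUnits.divHom_mapEquiv hF hF Ψ hΨ hb ΨΦ hdiv, divHom_ratIso hBg hΦd hF]

end Div

/-! ### § 3. The unit-ratio law for parallel linear pairs -/

/-- **Parallel linear arrows factor through a common pull-back arrow**: for `f, g : X → Y` of Frobenius degree `1` over
the same base arrow `b`, `f = s_f ≫ p` and `g = s_g ≫ p` with `s_f = (1, id, Div f, u_f)`, `s_g = (1, id, Div g, u_g) :
X → X′ := (X_D, b^* β)` base-identity linear and `p = (1, b, 0, 1) : X′ → Y = (Y_D, β)` ([FrdI] Thm 5.2 (i): relation (d)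
of `f` is relation (d) of `s_f`). [cite: MochizukiFrdI2008, Thm. 5.2(i) p.100] [claim: Mochizuki2012, status: disputed] -/
theorem exists_parallel_factorisation {X Y : ModelFrobenioid Φ B DivB} (f g : X ⟶ Y) (hf : degFr f = 1)
    (hg : degFr g = 1) (hfg : baseMap f = baseMap g) :
    ∃ (γ : Algebra.GrothendieckGroup (Φ.obj (op X.base)))
      (sf sg : X ⟶ (⟨X.base, γ⟩ : ModelFrobenioid Φ B DivB)) (p : (⟨X.base, γ⟩ : ModelFrobenioid Φ B DivB) ⟶ Y),
      f = sf ≫ p ∧ g = sg ≫ p ∧ degFr sf = 1 ∧ degFr sg = 1 ∧ baseMap sf = 𝟙 X.base ∧ baseMap sg = 𝟙 X.base ∧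
        degFr p = 1 ∧ unit sf = unit f ∧ unit sg = unit g := by
  have hrelf : X.cls ^ ((1 : ℕ+) : ℕ) * Algebra.GrothendieckGroup.of (div f) =
      pullGp Φ (𝟙 X.base) (pullGp Φ (baseMap f) Y.cls) * divB Φ B DivB (op X.base) (unit f) := by
    have h := rel f; rw [hf] at h; rwa [pullGp_id]
  have hrelg : X.cls ^ ((1 : ℕ+) : ℕ) * Algebra.GrothendieckGroup.of (div g) =
      pullGp Φ (𝟙 X.base) (pullGp Φ (baseMap f) Y.cls) * divB Φ B DivB (op X.base) (unit g) := by
    have h := rel g; rw [hg, ← hfg] at h; rwa [pullGp_id]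
  have hrelp : (pullGp Φ (baseMap f) Y.cls) ^ ((1 : ℕ+) : ℕ) * Algebra.GrothendieckGroup.of (1 : Φ.obj (op X.base)) =
      pullGp Φ (baseMap f) Y.cls * divB Φ B DivB (op X.base) 1 := by
    rw [PNat.one_coe, pow_one, map_one, mul_one, map_one, mul_one]
  refine ⟨pullGp Φ (baseMap f) Y.cls,
    mkHom X ⟨X.base, pullGp Φ (baseMap f) Y.cls⟩ 1 (𝟙 X.base) (div f) (unit f) hrelf,
    mkHom X ⟨X.base, pullGp Φ (baseMap f) Y.cls⟩ 1 (𝟙 X.base) (div g) (unit g) hrelg,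
    mkHom ⟨X.base, pullGp Φ (baseMap f) Y.cls⟩ Y 1 (baseMap (X := X) (Y := Y) f) 1 1 hrelp,
    ?_, ?_, rfl, rfl, rfl, rfl, rfl, rfl, rfl⟩
  · refine hom_ext (by rw [hf]; rfl) (Category.id_comp _).symm ?_ ?_
    · change div f = pull Φ (𝟙 X.base) 1 * div f ^ ((1 : ℕ+) : ℕ); rw [map_one, one_mul, PNat.one_coe, pow_one]
    · change unit f = pull B (𝟙 X.base) 1 * unit f ^ ((1 : ℕ+) : ℕ); rw [map_one, one_mul, PNat.one_coe, pow_one]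
  · refine hom_ext (by rw [hg]; rfl) (hfg.symm.trans (Category.id_comp _).symm) ?_ ?_
    · change div g = pull Φ (𝟙 X.base) 1 * div g ^ ((1 : ℕ+) : ℕ); rw [map_one, one_mul, PNat.one_coe, pow_one]
    · change unit g = pull B (𝟙 X.base) 1 * unit g ^ ((1 : ℕ+) : ℕ); rw [map_one, one_mul, PNat.one_coe, pow_one]

include hiso hdeg in
/-- **The unit-ratio law** ([FrdI] Thm 5.2 (ii) / Cor 4.10 at an ARBITRARY object): for parallel linear `f, g : X → Y`
(degree `1`, same base arrow), `u_{Ψ g} · T_X(u_f) = u_{Ψ f} · T_X(u_g)` in `B((Ψ X)_D)`.  Proof: § 3 factorisation; the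
fraction `(s_f, s_g)` at `X′` has unit part `r`, `r · u_f = u_g` (`pairUnit_spec`); `Ψ^birat[(s_f, s_g)] = [(Ψ s_f, Ψ s_g)]`
(`equivOfEquiv_mk`) has unit part `r₂`, `Base(Ψ s_f)^* r₂ · u_{Ψ s_f} = u_{Ψ s_g}`; `Base(Ψ s_f) = Base(Ψ s_g)`; § 1 along
`s_f`: `T_X(r) = Base(Ψ s_f)^* r₂`. [cite: MochizukiFrdI2008, Thm. 5.2 (ii) p.101] [claim: Mochizuki2012, status: disputed] -/
theorem ratTransport_ratio {X Y : ModelFrobenioid Φ B DivB} (f g : X ⟶ Y) (hf : degFr f = 1) (hg : degFr g = 1)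
    (hfg : baseMap f = baseMap g) :
    unit (Ψ.functor.map g) *
        (ratIso hBg hΦd hF (Ψ.functor.obj X)).symm
          (PreFrobenioid.BiratUnits.equivOfEquiv Ψ hΨ hb hF hF hΨ' hb' X (ratIso hBg hΦd hF X (unit f))) =
      unit (Ψ.functor.map f) *
        (ratIso hBg hΦd hF (Ψ.functor.obj X)).symm
          (PreFrobenioid.BiratUnits.equivOfEquiv Ψ hΨ hb hF hF hΨ' hb' X (ratIso hBg hΦd hF X (unit g))) := by
  obtain ⟨γ, sf, sg, p, hfac, hgac, hsf1, hsg1, hsfb, hsgb, hp1, husf, husg⟩ :=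
    exists_parallel_factorisation f g hf hg hfg
  haveI : IsIso (baseMap sf) := by rw [hsfb]; infer_instance
  haveI : IsIso (baseMap sg) := by rw [hsgb]; infer_instance
  have hsf : PreFrobenioid.IsCoAngularPreStep (toElem Φ B DivB) sf := ⟨isCoAngular hBg _, hsf1, ‹_›⟩
  have hsg : PreFrobenioid.IsCoAngularPreStep (toElem Φ B DivB) sg := ⟨isCoAngular hBg _, hsg1, ‹_›⟩
  have hbe : PreFrobenioid.BaseEquivalent (toElem Φ B DivB) sf sg := hsfb.trans hsgb.symm
  haveI : IsIso (baseMap (Ψ.functor.map sf)) := (hΨ sf hsf).2.2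
  -- the fraction `(s_f, s_g)` at `X′` and its unit part `r`: `r · u_f = u_g`
  let q : PreFrobenioid.RatFrac (toElem Φ B DivB) (⟨X.base, γ⟩ : ModelFrobenioid Φ B DivB) :=
    ⟨X, sf, sg, hsf, hsg, hbe⟩
  have hr : pull B (baseMap sf) (pairUnit hBg sf sg : B.obj (op X.base)) * unit sf = unit sg :=
    pairUnit_spec hBg sf sg
  rw [hsfb, pull_id, husf, husg] at hr
  -- `T_{X′}(r)` is the unit part `r₂` of the fraction `(Ψ s_f, Ψ s_g)` at `Ψ X′`
  have hT' : (ratIso hBg hΦd hF (Ψ.functor.obj ⟨X.base, γ⟩)).symm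
      (PreFrobenioid.BiratUnits.equivOfEquiv Ψ hΨ hb hF hF hΨ' hb' ⟨X.base, γ⟩
        (ratIso hBg hΦd hF ⟨X.base, γ⟩ (pairUnit hBg sf sg : B.obj (op X.base)))) =
      (pairUnit hBg (Ψ.functor.map sf) (Ψ.functor.map sg) : B.obj (op (Ψ.functor.obj ⟨X.base, γ⟩).base)) := by
    have hq : ratIso hBg hΦd hF ⟨X.base, γ⟩ (pairUnit hBg sf sg : B.obj (op X.base)) =
        PreFrobenioid.BiratUnits.mk hF q :=
      (ratIso_eq_mk_iff hBg hΦd hF _ (pairUnit hBg sf sg : B.obj (op X.base)) q).mpr rfl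
    have hq' : ratIso hBg hΦd hF (Ψ.functor.obj ⟨X.base, γ⟩)
        (pairUnit hBg (Ψ.functor.map sf) (Ψ.functor.map sg) : B.obj (op (Ψ.functor.obj ⟨X.base, γ⟩).base)) =
        PreFrobenioid.BiratUnits.mk hF (q.mapEquiv Ψ hΨ hb) :=
      (ratIso_eq_mk_iff hBg hΦd hF _
        (pairUnit hBg (Ψ.functor.map sf) (Ψ.functor.map sg) : B.obj (op (Ψ.functor.obj ⟨X.base, γ⟩).base))
        (q.mapEquiv Ψ hΨ hb)).mpr rfl
    rw [hq, PreFrobenioid.BiratUnits.equivOfEquiv_mk, MulEquiv.symm_apply_eq]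
    exact hq'.symm
  have hr₂ : pull B (baseMap (Ψ.functor.map sf))
        (pairUnit hBg (Ψ.functor.map sf) (Ψ.functor.map sg) : B.obj (op (Ψ.functor.obj ⟨X.base, γ⟩).base)) *
      unit (Ψ.functor.map sf) = unit (Ψ.functor.map sg) :=
    pairUnit_spec hBg (Ψ.functor.map sf) (Ψ.functor.map sg)
  -- § 1 along `s_f`: `T_X(r) = Base(Ψ s_f)^* r₂`
  have hN := ratTransport_pull hBg hΦd hF hiso Ψ hΨ hb hΨ' hb' hdeg sf hsf1 (pairUnit hBg sf sg : B.obj (op X.base))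
  rw [hsfb, pull_id, hT'] at hN
  -- the unit formulas for `Ψ f = Ψ s_f ≫ Ψ p`, `Ψ g = Ψ s_g ≫ Ψ p`
  have hbs : baseMap (Ψ.functor.map sg) = baseMap (Ψ.functor.map sf) := (hb sf sg hbe).symm
  have hUf : unit (Ψ.functor.map f) =
      pull B (baseMap (Ψ.functor.map sf)) (unit (Ψ.functor.map p)) * unit (Ψ.functor.map sf) := by
    rw [hfac, Functor.map_comp, unit_comp_pull, hdeg, hp1, PNat.one_coe, pow_one]
  have hUg : unit (Ψ.functor.map g) =
      pull B (baseMap (Ψ.functor.map sf)) (unit (Ψ.functor.map p)) *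
        (pull B (baseMap (Ψ.functor.map sf))
            (pairUnit hBg (Ψ.functor.map sf) (Ψ.functor.map sg) : B.obj (op (Ψ.functor.obj ⟨X.base, γ⟩).base)) *
          unit (Ψ.functor.map sf)) := by
    rw [hgac, Functor.map_comp, unit_comp_pull, hdeg, hp1, PNat.one_coe, pow_one, hbs, ← hr₂]
  have hTg : (ratIso hBg hΦd hF (Ψ.functor.obj X)).symm
      (PreFrobenioid.BiratUnits.equivOfEquiv Ψ hΨ hb hF hF hΨ' hb' X (ratIso hBg hΦd hF X (unit g))) =
      (ratIso hBg hΦd hF (Ψ.functor.obj X)).symm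
          (PreFrobenioid.BiratUnits.equivOfEquiv Ψ hΨ hb hF hF hΨ' hb' X
            (ratIso hBg hΦd hF X (pairUnit hBg sf sg : B.obj (op X.base)))) *
        (ratIso hBg hΦd hF (Ψ.functor.obj X)).symm
          (PreFrobenioid.BiratUnits.equivOfEquiv Ψ hΨ hb hF hF hΨ' hb' X (ratIso hBg hΦd hF X (unit f))) := by
    rw [← hr, map_mul, map_mul, map_mul]
  rw [hTg, hN, hUg, hUf, mul_assoc, mul_assoc, mul_assoc]
  congr 1
  exact mul_left_comm _ _ _

/-! ### § 4. Every object is linked to its zero object by base-identity linear arrows -/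

/-- **The zigzag `X = (A, α) ⟵ (A, −b) ⟶ (A, 0)`** of base-identity linear arrows, `α = a − b` with `a, b ∈ Φ(A)`:
`(1, id, a, 1)` and `(1, id, b, 1)` ([FrdI] Thm 5.2 (i); `Φ^gp` is the group of differences of `Φ`).
[cite: MochizukiFrdI2008, Thm. 5.2(i) p.100] [claim: Mochizuki2012, status: disputed] -/
theorem exists_linear_zigzag_zeroObj (X : ModelFrobenioid Φ B DivB) :
    ∃ (γ : Algebra.GrothendieckGroup (Φ.obj (op X.base)))
      (h₁ : (⟨X.base, γ⟩ : ModelFrobenioid Φ B DivB) ⟶ X)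
      (h₂ : (⟨X.base, γ⟩ : ModelFrobenioid Φ B DivB) ⟶ zeroObj Φ B DivB X.base),
      degFr h₁ = 1 ∧ baseMap h₁ = 𝟙 X.base ∧ degFr h₂ = 1 ∧ baseMap h₂ = 𝟙 X.base := by
  obtain ⟨a, b, hab⟩ := grothendieckGroup_exists_mul_of_eq_of X.cls
  have hrel₁ : ((Algebra.GrothendieckGroup.of b)⁻¹) ^ ((1 : ℕ+) : ℕ) * Algebra.GrothendieckGroup.of a =
      pullGp Φ (𝟙 X.base) X.cls * divB Φ B DivB (op X.base) 1 := by
    rw [PNat.one_coe, pow_one, pullGp_id, map_one, mul_one, ← hab, inv_mul_cancel_comm_assoc]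
  have hrel₂ : ((Algebra.GrothendieckGroup.of b)⁻¹) ^ ((1 : ℕ+) : ℕ) * Algebra.GrothendieckGroup.of b =
      pullGp Φ (𝟙 X.base) (1 : Algebra.GrothendieckGroup (Φ.obj (op X.base))) * divB Φ B DivB (op X.base) 1 := by
    rw [PNat.one_coe, pow_one, inv_mul_cancel, map_one, map_one, mul_one]
  exact ⟨(Algebra.GrothendieckGroup.of b)⁻¹,
    mkHom ⟨X.base, (Algebra.GrothendieckGroup.of b)⁻¹⟩ X 1 (𝟙 X.base) a 1 hrel₁,
    mkHom ⟨X.base, (Algebra.GrothendieckGroup.of b)⁻¹⟩ (zeroObj Φ B DivB X.base) 1 (𝟙 X.base) b 1 hrel₂,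
    rfl, rfl, rfl, rfl⟩

/-! ### § 5. Over the base: ONE natural automorphism `ᾱ` of `B`, and the (hratio) clause with `ᾱ` inserted -/

section OverBase

variable (e : ∀ X : ModelFrobenioid Φ B DivB, (Ψ.functor.obj X).base ≅ X.base)
  (hen : ∀ ⦃X Y : ModelFrobenioid Φ B DivB⦄ (φ : X ⟶ Y),
    baseMap (Ψ.functor.map φ) ≫ (e Y).hom = (e X).hom ≫ baseMap φ)

include hen in
/-- `Base(Ψ φ) = e_X ≫ Base(φ) ≫ e_Y⁻¹` for `Ψ` over the base through the natural base identification `e`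
(e.g. `e_X = η′_X` for `η′ : Ψ ⋙ Base ≅ Base`). [cite: MochizukiFrdI2008, Thm. 5.2(iv) p.102]
[claim: Mochizuki2012, status: disputed] -/
theorem baseMap_map_eq_of_overBase {X Y : ModelFrobenioid Φ B DivB} (φ : X ⟶ Y) :
    baseMap (Ψ.functor.map φ) = (e X).hom ≫ baseMap φ ≫ (e Y).inv := by
  rw [← Category.assoc, Iso.eq_comp_inv]
  exact hen φ

include hen in
/-- `Ψ` over the base preserves base-equivalent pairs (the Cor 4.10 hypothesis `hb` is automatic over the base).
[cite: MochizukiFrdI2008, Cor. 4.10 p.90] [claim: Mochizuki2012, status: disputed] -/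
theorem baseEquivalent_map_of_overBase ⦃X Y : ModelFrobenioid Φ B DivB⦄ (f g : X ⟶ Y)
    (h : PreFrobenioid.BaseEquivalent (toElem Φ B DivB) f g) :
    PreFrobenioid.BaseEquivalent (toElem Φ B DivB) (Ψ.functor.map f) (Ψ.functor.map g) := by
  change baseMap f = baseMap g at h
  change baseMap (Ψ.functor.map f) = baseMap (Ψ.functor.map g)
  rw [baseMap_map_eq_of_overBase Ψ e hen f, baseMap_map_eq_of_overBase Ψ e hen g, h]

include hen in
/-- `Ψ⁻¹` over the base preserves base-equivalent pairs (`Ψ (Ψ⁻¹ k) = ε_X ≫ k ≫ ε_Y⁻¹` for the counit `ε`, and the base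
arrow of `Ψ⁻¹ k` is read off that of `Ψ (Ψ⁻¹ k)` through `e`). [cite: MochizukiFrdI2008, Cor. 4.10 p.90]
[claim: Mochizuki2012, status: disputed] -/
theorem baseEquivalent_inverse_map_of_overBase ⦃X Y : ModelFrobenioid Φ B DivB⦄ (f g : X ⟶ Y)
    (h : PreFrobenioid.BaseEquivalent (toElem Φ B DivB) f g) :
    PreFrobenioid.BaseEquivalent (toElem Φ B DivB) (Ψ.inverse.map f) (Ψ.inverse.map g) := by
  change baseMap f = baseMap g at h
  change baseMap (Ψ.inverse.map f) = baseMap (Ψ.inverse.map g)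
  have hm : ∀ k : X ⟶ Y, baseMap (Ψ.inverse.map k) =
      (e (Ψ.inverse.obj X)).inv ≫
        (baseMap (Ψ.counit.app X) ≫ baseMap k ≫ baseMap (Ψ.counitInv.app Y)) ≫ (e (Ψ.inverse.obj Y)).hom := by
    intro k
    rw [← baseMap_comp, ← baseMap_comp, ← Equivalence.fun_inv_map, baseMap_map_eq_of_overBase Ψ e hen,
      Category.assoc, Category.assoc, Iso.inv_hom_id, Category.comp_id, Iso.inv_hom_id_assoc]
  rw [hm f, hm g, h]

variable (ΨΦ : (PreFrobenioidData.ofFunctor Φ (toElem Φ B DivB)).DivisorMonoidIsoOver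
    (PreFrobenioidData.ofFunctor Φ (toElem Φ B DivB)) Ψ)
  (hdiv : ∀ ⦃A A' : ModelFrobenioid Φ B DivB⦄ (φ : A ⟶ A'),
    ΨΦ.iso A (PreFrobenioid.Div (toElem Φ B DivB) φ) = PreFrobenioid.Div (toElem Φ B DivB) (Ψ.functor.map φ))

include hBg hΦd hF hiso hΨ hb hΨ' hb' hdeg hen hdiv in
/-- **[FrdI] Cor 4.10 / Thm 5.2 (ii) for a self-equivalence OVER THE BASE: the rational function monoid moves through ONE
natural automorphism `ᾱ` of `B`.**  `C = ModelFrobenioid Φ B DivB` (`B` group-like, `Φ` divisorial, `C → F_Φ` a Frobenioid of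
isotropic type), `Ψ : C ⥲ C` with `Ψ^{±1}` preserving co-angular pre-steps and base-equivalent pairs, `deg_Fr` preserved, `Ψ^Φ`
over `Ψ` carrying `Div φ ↦ Div(Ψ φ)`, a natural base identification `e_X : (Ψ X)_D ⥲ X_D`.  Then `ᾱ_A := (e⁻¹)^* ∘ T_{(A,0)}` is
(1) NATURAL on `D`; (2) `Div_B ∘ ᾱ_A = ε_A^gp ∘ Div_B` for a MONOID AUTOMORPHISM `ε_A` of `Φ(A)`; (3) for parallel linear
`f, g : X → Y`: `u_{Ψ f} · e_X^*(ᾱ(u_g)) = u_{Ψ g} · e_X^*(ᾱ(u_f))` — the (hratio) clause of the [IUTchI] Ex 5.1 (v) binder `hB`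
(★ `Cor53iArithHratOfMonoidRigidity`) with `ᾱ` inserted; `ᾱ = 1` is `hB`.
([IUTchI] Cor 5.3 (i) p.144) [cite: MochizukiFrdI2008, Thm. 5.2 (ii) p.101] [claim: Mochizuki2012, status: disputed] -/
theorem exists_unitsAut_of_selfEquivalence_over_base :
    ∃ ᾱ : ∀ A : D, B.obj (op A) ≃* B.obj (op A),
      (∀ ⦃A' A : D⦄ (g : A' ⟶ A) (w : B.obj (op A)), ᾱ A' (pull B g w) = pull B g (ᾱ A w)) ∧
      (∀ A : D, ∃ ε : Φ.obj (op A) ≃* Φ.obj (op A), ∀ w : B.obj (op A),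
        divB Φ B DivB (op A) (ᾱ A w) = MonGp.map ε.toMonoidHom (divB Φ B DivB (op A) w)) ∧
      ∀ ⦃X Y : ModelFrobenioid Φ B DivB⦄ (f g : X ⟶ Y), degFr f = 1 → degFr g = 1 → baseMap f = baseMap g →
        unit (Ψ.functor.map f) * pull B (e X).hom (ᾱ X.base (unit g)) =
          unit (Ψ.functor.map g) * pull B (e X).hom (ᾱ X.base (unit f)) := by
  -- the transport `T_X` and the base identification as (opaque) multiplicative equivalences
  obtain ⟨T, hT⟩ : ∃ T : ∀ X : ModelFrobenioid Φ B DivB, B.obj (op X.base) ≃* B.obj (op (Ψ.functor.obj X).base),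
      ∀ (X : ModelFrobenioid Φ B DivB) (w : B.obj (op X.base)), T X w =
        (ratIso hBg hΦd hF (Ψ.functor.obj X)).symm
          (PreFrobenioid.BiratUnits.equivOfEquiv Ψ hΨ hb hF hF hΨ' hb' X (ratIso hBg hΦd hF X w)) :=
    ⟨fun X => (ratIso hBg hΦd hF X).trans ((PreFrobenioid.BiratUnits.equivOfEquiv Ψ hΨ hb hF hF hΨ' hb' X).trans
      (ratIso hBg hΦd hF (Ψ.functor.obj X)).symm), fun X w => rfl⟩
  obtain ⟨E, hEs⟩ : ∃ E : ∀ X : ModelFrobenioid Φ B DivB, B.obj (op X.base) ≃* B.obj (op (Ψ.functor.obj X).base),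
      ∀ (X : ModelFrobenioid Φ B DivB) (w : B.obj (op (Ψ.functor.obj X).base)), (E X).symm w = pull B (e X).inv w :=
    ⟨fun X => (B.mapIso (e X).op).commMonCatIsoToMulEquiv, fun X w => rfl⟩
  -- injectivity of the pull-back along the base identification
  have hinj : ∀ X : ModelFrobenioid Φ B DivB, Function.Injective (pull B (e X).hom) := fun X a₁ a₂ h => by
    have h' := congrArg (pull B (e X).inv) h
    rwa [← pull_comp, ← pull_comp, Iso.inv_hom_id, pull_id, pull_id] at h'
  -- KEY: `T_X = e_X^* ∘ ᾱ_{X_D}` with `ᾱ_A := (e⁻¹)^* ∘ T_{(A,0)}` (§ 4 zigzag + § 1 twice)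
  have key : ∀ (X : ModelFrobenioid Φ B DivB) (w : B.obj (op X.base)),
      T X w = pull B (e X).hom (((T (zeroObj Φ B DivB X.base)).trans (E (zeroObj Φ B DivB X.base)).symm) w) := by
    intro X w
    obtain ⟨γ, h₁, h₂, h₁1, h₁b, h₂1, h₂b⟩ := exists_linear_zigzag_zeroObj X
    have n₁ := ratTransport_pull hBg hΦd hF hiso Ψ hΨ hb hΨ' hb' hdeg h₁ h₁1 w
    have n₂ := ratTransport_pull hBg hΦd hF hiso Ψ hΨ hb hΨ' hb' hdeg h₂ h₂1 w
    rw [h₁b, pull_id, baseMap_map_eq_of_overBase Ψ e hen h₁, h₁b, Category.id_comp] at n₁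
    rw [h₂b, pull_id, baseMap_map_eq_of_overBase Ψ e hen h₂, h₂b, Category.id_comp] at n₂
    rw [n₁, pull_comp, pull_comp] at n₂
    have n₃ := hinj _ n₂
    rw [MulEquiv.trans_apply, hEs, hT, hT, ← n₃, ← pull_comp, Iso.hom_inv_id, pull_id]
  refine ⟨fun A => (T (zeroObj Φ B DivB A)).trans (E (zeroObj Φ B DivB A)).symm, fun A' A g w => ?_,
    fun A => ?_, fun X Y f g hf hg hfg => ?_⟩
  · -- (1) naturality on `D`: § 1 along the zero lift `(1, g, 0, 1)`
    dsimp only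
    have n : (ratIso hBg hΦd hF (Ψ.functor.obj (zeroObj Φ B DivB A'))).symm
        (PreFrobenioid.BiratUnits.equivOfEquiv Ψ hΨ hb hF hF hΨ' hb' (zeroObj Φ B DivB A')
          (ratIso hBg hΦd hF (zeroObj Φ B DivB A') (pull B g w))) =
        pull B (baseMap (Ψ.functor.map (zeroHom (Φ := Φ) (B := B) (DivB := DivB) 1 g)))
          ((ratIso hBg hΦd hF (Ψ.functor.obj (zeroObj Φ B DivB A))).symm
            (PreFrobenioid.BiratUnits.equivOfEquiv Ψ hΨ hb hF hF hΨ' hb' (zeroObj Φ B DivB A)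
              (ratIso hBg hΦd hF (zeroObj Φ B DivB A) w))) :=
      ratTransport_pull hBg hΦd hF hiso Ψ hΨ hb hΨ' hb' hdeg (zeroHom (Φ := Φ) (B := B) (DivB := DivB) 1 g) rfl w
    have hz : (e (zeroObj Φ B DivB A')).hom ≫ baseMap (zeroHom (Φ := Φ) (B := B) (DivB := DivB) 1 g) ≫
        (e (zeroObj Φ B DivB A)).inv = (e (zeroObj Φ B DivB A')).hom ≫ g ≫ (e (zeroObj Φ B DivB A)).inv := rfl
    rw [baseMap_map_eq_of_overBase Ψ e hen, hz] at n
    rw [MulEquiv.trans_apply, MulEquiv.trans_apply, hEs, hEs, hT, hT, n, ← pull_comp, ← pull_comp,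
      Iso.inv_hom_id_assoc]
  · -- (2) `Div_B`-compatibility through the monoid automorphism `(e⁻¹)^* ∘ Ψ^Φ_{(A,0)}` of `Φ(A)`
    dsimp only
    let ε₂ : Φ.obj (op (Ψ.functor.obj (zeroObj Φ B DivB A)).base) ≃* Φ.obj (op A) :=
      (Φ.mapIso (e (zeroObj Φ B DivB A)).op).commMonCatIsoToMulEquiv.symm
    refine ⟨(ΨΦ.iso (zeroObj Φ B DivB A)).trans ε₂, fun w => ?_⟩
    have hε : ((ΨΦ.iso (zeroObj Φ B DivB A)).trans ε₂).toMonoidHom =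
        ε₂.toMonoidHom.comp (ΨΦ.iso (zeroObj Φ B DivB A)).toMonoidHom := MonoidHom.ext fun _ => rfl
    have hε₂ : MonGp.map ε₂.toMonoidHom = pullGp Φ (e (zeroObj Φ B DivB A)).inv :=
      congrArg MonGp.map (MonoidHom.ext fun _ => rfl)
    rw [MulEquiv.trans_apply, hEs, hT, ← pullGp_divB_pull,
      ratTransport_divB' hBg hΦd hF Ψ hΨ hb hΨ' hb' ΨΦ hdiv, hε, MonGp.map_comp, MonoidHom.comp_apply, hε₂]
    rfl
  · -- (3) the ratio law: § 3 with `T_X = e_X^* ∘ ᾱ_{X_D}`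
    dsimp only
    have h := ratTransport_ratio hBg hΦd hF hiso Ψ hΨ hb hΨ' hb' hdeg f g hf hg hfg
    rw [← hT, ← hT, key, key] at h
    exact h.symm

include hBg hΦd hF hiso hΨ hΨ' hdeg hdiv in
/-- **The same, for `Ψ` over the base through `η′ : Ψ ⋙ Base ≅ Base`** (the shape of the [IUTchI] Ex 5.1 (v) binder `hB`):
the Cor 4.10 hypotheses on base-equivalent pairs are discharged by `η′`, and the ratio law reads
`u_{Ψ f} · η′_X^*(ᾱ_{X_D}(u_g)) = u_{Ψ g} · η′_X^*(ᾱ_{X_D}(u_f))` for parallel linear `f, g`.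
([IUTchI] Cor 5.3 (i) p.144) [cite: MochizukiFrdI2008, Thm. 5.2 (ii) p.101] [claim: Mochizuki2012, status: disputed] -/
theorem exists_unitsAut_of_selfEquivalence_over_baseIso
    (η' : Ψ.functor ⋙ baseFunctor Φ B DivB ≅ baseFunctor Φ B DivB) :
    ∃ ᾱ : ∀ A : D, B.obj (op A) ≃* B.obj (op A),
      (∀ ⦃A' A : D⦄ (g : A' ⟶ A) (w : B.obj (op A)), ᾱ A' (pull B g w) = pull B g (ᾱ A w)) ∧
      (∀ A : D, ∃ ε : Φ.obj (op A) ≃* Φ.obj (op A), ∀ w : B.obj (op A),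
        divB Φ B DivB (op A) (ᾱ A w) = MonGp.map ε.toMonoidHom (divB Φ B DivB (op A) w)) ∧
      ∀ ⦃X Y : ModelFrobenioid Φ B DivB⦄ (f g : X ⟶ Y), degFr f = 1 → degFr g = 1 → baseMap f = baseMap g →
        unit (Ψ.functor.map f) *
            pull B (A := X.base) (B := (Ψ.functor.obj X).base) (η'.hom.app X) (ᾱ X.base (unit g)) =
          unit (Ψ.functor.map g) *
            pull B (A := X.base) (B := (Ψ.functor.obj X).base) (η'.hom.app X) (ᾱ X.base (unit f)) :=
  exists_unitsAut_of_selfEquivalence_over_base hBg hΦd hF hiso Ψ hΨ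
    (baseEquivalent_map_of_overBase Ψ (fun X => η'.app X) (fun _ _ φ => η'.hom.naturality φ)) hΨ'
    (baseEquivalent_inverse_map_of_overBase Ψ (fun X => η'.app X) (fun _ _ φ => η'.hom.naturality φ)) hdeg
    (fun X => η'.app X) (fun _ _ φ => η'.hom.naturality φ) ΨΦ hdiv

end OverBase

end ModelFrobenioid

end Literature.AlgebraicGeometry.Frobenioids

end
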